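import Literature.NumberTheory.Transcendental.RoySmallValueStep2Pkg
import Literature.NumberTheory.Transcendental.RoySmallValueDistanceLower
import HarnessLib

/-!
# Roy's small value estimate for `𝔾ₐ × 𝔾ₘ` — §7 Step 2: the test forms of `𝒞_D` detecting the distance to `(1:γ)` and to `A_γ`

Topic `Literature/NumberTheory/Transcendental`. Part of the formalisation of the proof of Roy 2013,
Theorem 1.1 (named fact `roy2013_thm_1_1`, `RoySmallValueEstimates.lean`), seat B. Source: D. Roy,
*A small value estimate for `𝔾ₐ × 𝔾ₘ`*, Mathematika 59 (2013) 333–363 = arXiv:1301.0663, §7,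
Step 2 (p. 18 of the arXiv text):

> `sup{|P(α)| ; P ∈ 𝒞_D} ≥ sup{|P(α)| ; P ∈ I_D^{(γ,T)}, ‖P‖ ≤ 1} = |I_D^{(γ,T)}|_α`. Now, [...]
> Proposition 4.2 gives `|I_D^{(γ,T)}|_α ≥ c₅^{−T} T^{−6T log T} dist(α,(1:γ))^T` [...] For the
> more interesting points `α ∈ 𝒰`, it gives
> `|I_D^{(γ,T)}|_α ≥ c₄⁻¹c₅^{−T}T^{−6T log T} max{dist(α,(1:γ))^T, dist(α, A_γ)}`.

In test-family language: an element `P ∈ I_D^{(γ,T)} ∖ 0` rescaled to `R = (e^Y/‖P‖)·P` lies in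
Roy's body `𝒞 = royBody D ξ η Y U T` for EVERY `U` (its first `T` derivatives vanish at `(1, γ)`),
with `|R(α)| = e^Y |P(α)|/‖P‖` (`smul_mem_royBody_of_mem_vanIdeal`, `norm_eval_smul`). With the
forms supplied by the parallel seat's `prop_4_5_i` / `prop_4_5_ii` (Roy's Proposition 4.2) this gives
tests `R ∈ 𝒞` with `e^Y dist(α,(1:γ))^T ≤ 2^T Λ^k |R(α)|` (`exists_test_pdist`) and
`e^Y dist(α, A_γ) ≤ C Λ^k |R(α)| + e^Y C' dist(α,(1:γ))^T` (`exists_test_adist`), for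
sup-normalised representatives `α`. Everything is proved; no definitions, no named facts.

## References

* [Roy2013] D. Roy, *A small value estimate for 𝔾ₐ × 𝔾ₘ*, Mathematika 59 (2013), 333–363
  (arXiv:1301.0663), §7, Step 2 and Proposition 4.2.
-/

noncomputable section

open MvPolynomial Finset

namespace Literature.NumberTheory.Transcendental

namespace Roy2013

open Nesterenko

/-! ### Rescaled elements of `I_D^{(γ,T)}` are tests -/

/-- The value of a rescaled form. [folklore] -/
theorem norm_eval_smul_real (r : ℝ) (P : CX) (β : Fin 3 → ℂ) :
    ‖eval β (((r : ℝ) : ℂ) • P)‖ = |r| * ‖eval β P‖ := by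
  rw [smul_eq_C_mul, map_mul, eval_C, norm_mul, Complex.norm_real, Real.norm_eq_abs]

/-- **`(e^Y/‖P‖) P ∈ 𝒞` for `P ∈ I_D^{(γ,T)} ∖ 0`**, for every `U`. [cite: Roy2013, §7, Step 2 ("`sup{|P(α)| ; P ∈ 𝒞_D} ≥ |I_D^{(γ,T)}|_α`")] -/
theorem smul_mem_royBody_of_mem_vanIdeal {D : ℕ} {ξ η : ℂ} {T : ℕ} {P : CX}
    (hP : P.IsHomogeneous D) (hPv : P ∈ vanIdeal ξ η T) (hP0 : P ≠ 0) (Y U : ℝ) :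
    (((Real.exp Y / maxNorm P : ℝ) : ℂ) • P) ∈ royBody D ξ η Y U T := by
  have hpos : 0 < maxNorm P := maxNorm_pos hP0
  refine ⟨?_, ?_, fun i hi => ?_⟩
  · rw [smul_eq_C_mul]; exact hP.C_mul _
  · rw [smul_eq_C_mul, maxNorm_C_mul, Complex.norm_real, Real.norm_eq_abs,
      abs_of_pos (div_pos (Real.exp_pos Y) hpos), div_mul_cancel₀ _ hpos.ne']
  · rw [iterate_homD_smul, map_smul, (mem_vanIdeal_iff.mp hPv) i hi, smul_zero, norm_zero]
    exact (Real.exp_pos _).le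

/-- The value of the rescaled test. [folklore] -/
theorem norm_eval_test {P : CX} (hP0 : P ≠ 0) (Y : ℝ) (β : Fin 3 → ℂ) :
    ‖eval β ((((Real.exp Y / maxNorm P : ℝ) : ℂ)) • P)‖ = Real.exp Y / maxNorm P * ‖eval β P‖ := by
  rw [norm_eval_smul_real, abs_of_pos (div_pos (Real.exp_pos Y) (maxNorm_pos hP0))]

/-! ### The tests of Step 2 -/

/-- **A test of `𝒞_D` detecting `dist(α,(1:γ))`**: for a sup-normalised `α` there is `R ∈ 𝒞`
with `e^Y dist(α,(1:γ))^T ≤ 2^T Λ^k |R(α)|` (`Λ = 3(3(1+|ξ|+|η|⁻¹)c₂)^T (16T³)^T`, the constant of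
`prop_4_5_i`). [cite: Roy2013, §7, Step 2 (points outside `𝒰`) and Proposition 4.2] -/
theorem exists_test_pdist {ξ η : ℂ} (hη : η ≠ 0) {L T D k : ℕ} (hT₁ : (L + 1).choose 2 < T)
    (hT₂ : T ≤ (L + 2).choose 2) (hD : 3 * (L + 1) ≤ D) (hDT : D ≤ T)
    (hk : 2 ^ k * T ≤ 3 ^ k * D) {α : Fin 3 → ℂ} (hα : ∀ i, ‖α i‖ ≤ 1) (Y U : ℝ) :
    ∃ R ∈ royBody D ξ η Y U T,
      Real.exp Y * pdist ξ η α ^ T ≤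
        2 ^ T * (3 * (3 * (1 + ‖ξ‖ + ‖η‖⁻¹) * max 1 (max ‖ξ‖ ‖η‖)) ^ T *
          (16 * (T : ℝ) ^ 3) ^ T) ^ k * ‖eval α R‖ := by
  obtain ⟨P, hPh, hPv, hP0, hineq⟩ := prop_4_5_i hη hT₁ hT₂ hD hDT hk hα
  have hpos : 0 < maxNorm P := maxNorm_pos hP0
  refine ⟨_, smul_mem_royBody_of_mem_vanIdeal hPh hPv hP0 Y U, ?_⟩
  rw [norm_eval_test hP0, show (eval α P : ℂ) = aeval α P from rfl]
  -- divide `hineq` by `‖P‖` and multiply by `e^Y`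
  have h1 : pdist ξ η α ^ T ≤
      2 ^ T * (3 * (3 * (1 + ‖ξ‖ + ‖η‖⁻¹) * max 1 (max ‖ξ‖ ‖η‖)) ^ T *
        (16 * (T : ℝ) ^ 3) ^ T) ^ k * (‖aeval α P‖ / maxNorm P) := by
    rw [← mul_div_assoc, le_div_iff₀ hpos, mul_comm (pdist ξ η α ^ T)]
    exact hineq
  have hY0 : 0 < Real.exp Y := Real.exp_pos Y
  calc Real.exp Y * pdist ξ η α ^ T
      ≤ Real.exp Y * (2 ^ T * (3 * (3 * (1 + ‖ξ‖ + ‖η‖⁻¹) * max 1 (max ‖ξ‖ ‖η‖)) ^ T *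
          (16 * (T : ℝ) ^ 3) ^ T) ^ k * (‖aeval α P‖ / maxNorm P)) :=
        mul_le_mul_of_nonneg_left h1 hY0.le
    _ = _ := by ring

/-- **A test of `𝒞_D` detecting `dist(α, A_γ)`** at a point of `𝒰` (chart `|α₀| ≥ (2c₂)⁻¹`,
`dist(α,(1:γ)) ≤ (2c₂)⁻¹`): there is `R ∈ 𝒞` with
`e^Y dist(α,A_γ) ≤ C Λ^k |R(α)| + e^Y C' dist(α,(1:γ))^T` (constants of `prop_4_5_ii`).
[cite: Roy2013, §7, Step 2 (points of `𝒰`) and Proposition 4.2] -/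
theorem exists_test_adist {ξ η : ℂ} (hη : η ≠ 0) {L T D k : ℕ} (hT₁ : (L + 1).choose 2 < T)
    (hT₂ : T ≤ (L + 2).choose 2) (hD : 3 * (L + 1) ≤ D) (hDT : D ≤ T)
    (hk : 2 ^ k * T ≤ 3 ^ k * D) {α : Fin 3 → ℂ} (hα : ∀ i, ‖α i‖ ≤ 1)
    (hα0 : (2 * roy_c2 ξ η)⁻¹ ≤ ‖α 0‖) (hd : pdist ξ η α ≤ (2 * roy_c2 ξ η)⁻¹) (Y U : ℝ) :
    ∃ R ∈ royBody D ξ η Y U T,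
      Real.exp Y * adist ξ η α ≤
        (2 * roy_c2 ξ η) ^ T * (1 + roy_c2 ξ η * Real.exp (1 + roy_c2 ξ η)) *
          (3 * (3 * (1 + ‖ξ‖ + ‖η‖⁻¹) * max 1 (max ‖ξ‖ ‖η‖)) ^ T *
            (16 * (T : ℝ) ^ 3) ^ T) ^ k * ‖eval α R‖ +
        Real.exp Y * (roy_c2 ξ η * Real.exp (roy_c2 ξ η) * (2 * roy_c2 ξ η ^ 2) ^ T *
          pdist ξ η α ^ T) := by
  obtain ⟨P, hPh, hPv, hP0, hineq⟩ := prop_4_5_ii hη hT₁ hT₂ hD hDT hk hα hα0 hd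
  have hpos : 0 < maxNorm P := maxNorm_pos hP0
  refine ⟨_, smul_mem_royBody_of_mem_vanIdeal hPh hPv hP0 Y U, ?_⟩
  rw [norm_eval_test hP0, show (eval α P : ℂ) = aeval α P from rfl]
  -- abbreviate the constants
  obtain ⟨C₁, hC₁⟩ : ∃ C₁ : ℝ, C₁ = (2 * roy_c2 ξ η) ^ T * (1 + roy_c2 ξ η * Real.exp (1 + roy_c2 ξ η)) *
      (3 * (3 * (1 + ‖ξ‖ + ‖η‖⁻¹) * max 1 (max ‖ξ‖ ‖η‖)) ^ T * (16 * (T : ℝ) ^ 3) ^ T) ^ k :=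
    ⟨_, rfl⟩
  obtain ⟨C₂, hC₂⟩ : ∃ C₂ : ℝ, C₂ = roy_c2 ξ η * Real.exp (roy_c2 ξ η) * (2 * roy_c2 ξ η ^ 2) ^ T *
      pdist ξ η α ^ T := ⟨_, rfl⟩
  rw [← hC₁, ← hC₂] at hineq ⊢
  -- divide by `‖P‖`, multiply by `e^Y`
  have h1 : adist ξ η α ≤ C₁ * (‖aeval α P‖ / maxNorm P) + C₂ := by
    have h2 : maxNorm P * adist ξ η α ≤ maxNorm P * (C₁ * (‖aeval α P‖ / maxNorm P) + C₂) := by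
      have h3 : maxNorm P * (C₁ * (‖aeval α P‖ / maxNorm P) + C₂) =
          C₁ * ‖aeval α P‖ + maxNorm P * C₂ := by
        field_simp
      rw [h3]; exact hineq
    exact le_of_mul_le_mul_left h2 hpos
  have hY0 : 0 < Real.exp Y := Real.exp_pos Y
  calc Real.exp Y * adist ξ η α ≤ Real.exp Y * (C₁ * (‖aeval α P‖ / maxNorm P) + C₂) :=
        mul_le_mul_of_nonneg_left h1 hY0.le
    _ = C₁ * (Real.exp Y / maxNorm P * ‖aeval α P‖) + Real.exp Y * C₂ := by ring

end Roy2013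

end Literature.NumberTheory.Transcendental
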